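import Mathlib
import HarnessLib
import Literature.Analysis.FluidPDE.CheskidovDaiOccupationHolds
import Literature.Analysis.FluidPDE.CheskidovDaiCovered
import Literature.Analysis.FluidPDE.CheskidovShvydkoyAssembly
import Literature.Analysis.FluidPDE.TaoLocalisationHolds
import Literature.Analysis.FluidPDE.TaoLocalisationProofs

/-!
# RootDecompIntermittency — crux `NoThinFrontierBlowup` (stmt-NavierStokesRegularity-27233), stub `stub_cs14Criterion`

Registered stub (writer g11 skeleton `NoThinFrontierBlowup_line.lean`, 2026-08-30: the Cheskidov–Shvydkoy 2014 /
Cheskidov–Dai 2015 CRITERION leg of the line `stub_cs14Criterion ∧ stub_frontierL2Apriori ∧ stub_thickBelowThinDeficit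
⟹ NoThinFrontierBlowup`), PROVED here verbatim: there is an absolute `c_s ∈ (0,1]` such that for every threshold
`c₀ ∈ (0, c_s]`, every classical Navier–Stokes solution on `ℝ³ × [0,T)`, Leray–Hopf from its rapidly decaying datum,
whose critical dissipation-range functional `τ ↦ sup_{2^j ≤ Λ_{c₀,ν}(u(τ))} 2^j ‖Δ̇_j u(τ)‖_∞` is integrable on some
terminal window `(t₀, T)`, extends smoothly past `T`.

Proof (no new estimate): the tree's PROVED house form of Cheskidov–Dai 2015 Thm 1.1
`Literature.Analysis.FluidPDE.cheskidov_dai_occupation_holds` (absolute `c > 0`; hypothesis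
`limsup_q ∫_{(T/2,T)} 1_{2^q ≤ Λ_{c,ν}(u τ)} 2^q ‖Δ̇_q u(τ)‖_∞ dτ ≤ c`) with `c_s := min c 1`. For `c₀ ≤ c` the
dissipation wavenumber is antitone in the threshold (`dissipationWavenumber_anti`), so the occupation integrand at
threshold `c` is dominated pointwise by the critical functional at threshold `c₀`. The window `(T/2,T)` is split at
`T − δ`: (i) absolute continuity of the finite integral (`tendsto_setLIntegral_zero`) gives `δ > 0` with
`∫_{(T−δ,T)} sup_j … ≤ c`; (ii) on the closed slab `[0, T−δ]` all Sobolev norms of the classical solution are bounded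
(Tao 2013 Cor 11.1, tree `tao2011_hasBoundedSobolevNormsOn_holds`), so the dyadic `Ḣ¹` energy `F(u(τ))` is uniformly
bounded (`LPBounds.dyadicF_le_gradSq`) and every saturated level obeys `2^j ≤ (20 C_∞)² F /(cν)²`
(`two_pow_le_of_isSaturatedLevel`, Cheskidov–Dai (3.9)); hence `Λ_{c,ν}(u τ) < 2^q` on `[0,T−δ]` for `q ≥ q₁` and the
occupation integrand vanishes there. So every occupation integral with `q ≥ q₁` is at most `c`, the `limsup` too, and
the criterion fires. No measurability or convergence theorem is needed beyond (i). With this stub closed the crux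
reduces, kernel-checked (`NoThinFrontierBlowup_of` of the registered skeleton; `stub_frontierL2Apriori` landed
p792929), to its one mathematical stub `stub_thickBelowThinDeficit`. Navier–Stokes regularity is NOT proved by
anything here (rung 0). decomp-ns writer g13.
[cite: CheskidovDai2015, §1 Thm. 1.1 (case b ≡ 0, r = ∞); CheskidovShvydkoy2011, §3 (definition of Λ)]
-/

-- the summit and its single sub-problem share the name (CONVENTIONS §1), as in every Theorems file
set_option linter.dupNamespace false

open MeasureTheory Set Filter Topology Function
open scoped ENNReal NNReal

namespace Summit.NavierStokesRegularity.NavierStokesRegularity.Theorems.NoThinFrontierBlowup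

open Literature.Analysis.FluidPDE Literature.Analysis.FunctionSpaces

/-- **The gradient `L²` energy against the first Sobolev bound**: `∑_i ‖∂_i v‖₂² ≤ 3 ∫⁻ ‖Dv‖ₑ²` on `ℝ³`.
[folklore] -/
theorem gradSq_le_three_mul_lintegral (v : (EuclideanSpace ℝ (Fin 3)) → (EuclideanSpace ℝ (Fin 3))) :
    LPBounds.gradSq v ≤ 3 * ∫⁻ x, ‖iteratedFDeriv ℝ 1 v x‖ₑ ^ 2 := by
  unfold LPBounds.gradSq
  have hcard : (Finset.univ : Finset (Fin (Module.finrank ℝ (EuclideanSpace ℝ (Fin 3))))).card = 3 := by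
    rw [Finset.card_univ, Fintype.card_fin, finrank_euclideanSpace_fin]
  have hterm : ∀ i : Fin (Module.finrank ℝ (EuclideanSpace ℝ (Fin 3))),
      eLpNorm (fun x => fderiv ℝ v x (stdOrthonormalBasis ℝ (EuclideanSpace ℝ (Fin 3)) i)) 2 volume ^ 2 ≤
        ∫⁻ x, ‖iteratedFDeriv ℝ 1 v x‖ₑ ^ 2 := by
    intro i
    rw [Literature.Analysis.FunctionSpaces.eLpNorm_two_pow_two_eq_lintegral]
    refine lintegral_mono fun x => ?_
    have h1 : ‖fderiv ℝ v x (stdOrthonormalBasis ℝ (EuclideanSpace ℝ (Fin 3)) i)‖ ≤ ‖iteratedFDeriv ℝ 1 v x‖ := by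
      calc ‖fderiv ℝ v x (stdOrthonormalBasis ℝ (EuclideanSpace ℝ (Fin 3)) i)‖
          ≤ ‖fderiv ℝ v x‖ * ‖stdOrthonormalBasis ℝ (EuclideanSpace ℝ (Fin 3)) i‖ := ContinuousLinearMap.le_opNorm _ _
        _ = ‖fderiv ℝ v x‖ := by rw [(stdOrthonormalBasis ℝ (EuclideanSpace ℝ (Fin 3))).orthonormal.1 i, mul_one]
        _ = ‖iteratedFDeriv ℝ 1 v x‖ := by
            rw [← norm_iteratedFDeriv_fderiv (n := 0), norm_iteratedFDeriv_zero]
    have h2 : ‖fderiv ℝ v x (stdOrthonormalBasis ℝ (EuclideanSpace ℝ (Fin 3)) i)‖ₑ ≤ ‖iteratedFDeriv ℝ 1 v x‖ₑ := by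
      rw [← ofReal_norm, ← ofReal_norm]
      exact ENNReal.ofReal_le_ofReal h1
    exact pow_le_pow_left' h2 2
  calc ∑ i, eLpNorm (fun x => fderiv ℝ v x (stdOrthonormalBasis ℝ (EuclideanSpace ℝ (Fin 3)) i)) 2 volume ^ 2
      ≤ ∑ _i : Fin (Module.finrank ℝ (EuclideanSpace ℝ (Fin 3))), ∫⁻ x, ‖iteratedFDeriv ℝ 1 v x‖ₑ ^ 2 :=
        Finset.sum_le_sum fun i _ => hterm i
    _ = 3 * ∫⁻ x, ‖iteratedFDeriv ℝ 1 v x‖ₑ ^ 2 := by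
        rw [Finset.sum_const, hcard, nsmul_eq_mul]; push_cast; ring

/-- **Uniform cut-off of the dissipation range below the final time.** For a classical Navier–Stokes solution on
`ℝ³ × [0,T)`, Leray–Hopf from its rapidly decaying datum, and `T₁ < T`, `cν > 0`: there is a level `q₁` above which
no level is saturated at any time of `[0, T₁]`, i.e. `¬ 2^q ≤ Λ_{c,ν}(u τ)` for `q ≥ q₁`, `τ ∈ [0,T₁]` — all Sobolev
norms are bounded on the closed slab (Tao), so the dyadic `Ḣ¹` energy is bounded and Cheskidov–Dai's (3.9) caps the
saturated levels. [cite: CheskidovDai2015, §3.1 (3.9)] -/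
theorem exists_level_cutoff_of_classical {ν T : ℝ} (hν : 0 < ν)
    {u : ℝ → (EuclideanSpace ℝ (Fin 3)) → (EuclideanSpace ℝ (Fin 3))} {p : ℝ → (EuclideanSpace ℝ (Fin 3)) → ℝ}
    (hsol : IsClassicalNSSolutionOn (Ico 0 T) ν 0 u p) (hLH : IsLerayHopfOn T ν 0 (u 0) u)
    (h₀ : HasRapidSpatialDecay (u 0)) {c : ℝ} (hc : 0 < c) {T₁ : ℝ} (hT₁ : T₁ ∈ Ioo 0 T) :
    ∃ q₁ : ℕ, ∀ q : ℕ, q₁ ≤ q → ∀ τ ∈ Icc 0 T₁,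
      ¬ (2 : ℝ≥0∞) ^ q ≤ dissipationWavenumber c ν (u τ) := by
  set K := lpBounds (Fin 3) with hK
  have hcν : 0 < c * ν := mul_pos hc hν
  -- the closed slab `[0, T₁]`: classical, finite energy, all Sobolev norms bounded (Tao)
  have hsol₁ : IsClassicalNSSolutionOn (Icc 0 T₁) ν 0 u p :=
    hsol.mono (Icc_subset_Ico_right hT₁.2) (uniqueDiffOn_Icc hT₁.1)
  have hEn : ∃ C : ℝ≥0∞, C < ⊤ ∧ ∀ t ∈ Icc 0 T₁, ∫⁻ x, ‖u t x‖ₑ ^ 2 ≤ C :=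
    ⟨ENNReal.ofReal (2 * VectorCalculus.kineticEnergy (u 0)), ENNReal.ofReal_lt_top, fun t ht =>
      hLH.lintegral_enorm_sq_le hν.le ⟨ht.1, ht.2.trans hT₁.2.le⟩⟩
  have hH : HasBoundedSobolevNormsOn (Icc 0 T₁) u :=
    (tao2011_hasBoundedSobolevNormsOn.closedSlab tao2011_hasBoundedSobolevNormsOn_holds
      linfty_bound_of_hasBoundedSobolevNormsOn_holds ν T₁ hν hT₁.1 u p hsol₁ hEn h₀).1
  have hsm : ∀ t ∈ Icc 0 T₁, IsSmoothL2Field (u t) := fun t ht =>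
    isSmoothL2Field_of_sobolev (hsol₁.contDiff_velocity ht) fun n => by
      obtain ⟨C, hC⟩ := hH n
      exact (hC t ht).trans_lt ENNReal.coe_lt_top
  -- the dyadic `Ḣ¹` energy is uniformly bounded on the slab
  obtain ⟨C₁, hC₁⟩ := hH 1
  set D : ℝ≥0∞ := 8 * ((Fintype.card (Fin 3) : ℝ≥0∞) * ((K.Cr : ℝ≥0∞) ^ 2 * (3 * (C₁ : ℝ≥0∞)))) with hD
  have hDtop : D ≠ ∞ := by
    refine ENNReal.mul_ne_top (by norm_num) (ENNReal.mul_ne_top (ENNReal.natCast_ne_top _)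
      (ENNReal.mul_ne_top (ENNReal.pow_ne_top ENNReal.coe_ne_top)
        (ENNReal.mul_ne_top (by norm_num) ENNReal.coe_ne_top)))
  have hF : ∀ t ∈ Icc 0 T₁, dyadicF (u t) ≤ D := by
    intro t ht
    refine (K.dyadicF_le_gradSq (hsm t ht)).trans ?_
    rw [hD]
    gcongr
    exact (gradSq_le_three_mul_lintegral (u t)).trans (by gcongr; exact hC₁ t ht)
  -- Cheskidov–Dai (3.9): saturated levels are capped
  set B : ℝ := (20 * K.Cinf) ^ 2 * D.toReal / (c * ν) ^ 2 with hB
  have hsat : ∀ t ∈ Icc 0 T₁, ∀ j : ℕ, IsSaturatedLevel c ν (u t) j → (2 : ℝ) ^ j ≤ B := by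
    intro t ht j hj
    have hFt : dyadicF (u t) ≠ ∞ := ne_top_of_le_ne_top hDtop (hF t ht)
    refine (two_pow_le_of_isSaturatedLevel K hcν (hsm t ht) hFt hj).trans ?_
    rw [hB]
    gcongr
    exact hF t ht
  -- the cut-off level
  obtain ⟨q₁, hq₁⟩ := exists_nat_gt B
  refine ⟨q₁ + 1, fun q hq τ hτ hle => ?_⟩
  rw [two_pow_le_dissipationWavenumber_iff] at hle
  rcases hle with h0 | ⟨j, hqj, hj⟩
  · omega
  · have h1 := hsat τ hτ j hj
    have h2 : (q₁ : ℝ) < (2 : ℝ) ^ q₁ := by exact_mod_cast Nat.lt_two_pow_self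
    have h3 : (2 : ℝ) ^ q₁ ≤ (2 : ℝ) ^ j := pow_le_pow_right₀ one_le_two (by omega)
    linarith

/-- **The occupation integrand at threshold `c` is dominated by the critical functional at any smaller threshold
`c₀ ≤ c`** (antitonicity of `Λ` in the threshold). [cite: CheskidovShvydkoy2011, §3 (definition of Λ)] -/
theorem occupation_le_criticalSup {c₀ c ν : ℝ} (hc : c₀ ≤ c) (hν : 0 ≤ ν) (v : (EuclideanSpace ℝ (Fin 3)) → (EuclideanSpace ℝ (Fin 3))) (q : ℕ) :
    {w : (EuclideanSpace ℝ (Fin 3)) → (EuclideanSpace ℝ (Fin 3)) | (2 : ℝ≥0∞) ^ q ≤ dissipationWavenumber c ν w}.indicator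
        (fun w => (2 : ℝ≥0∞) ^ q * eLpNorm (blockFn (q : ℤ) w) ∞ volume) v ≤
      ⨆ (j : ℕ) (_ : (2 : ℝ≥0∞) ^ j ≤ dissipationWavenumber c₀ ν v),
        (2 : ℝ≥0∞) ^ j * eLpNorm (blockFn (j : ℤ) v) ⊤ volume := by
  by_cases h : (2 : ℝ≥0∞) ^ q ≤ dissipationWavenumber c ν v
  · have hmem : v ∈ {w : (EuclideanSpace ℝ (Fin 3)) → (EuclideanSpace ℝ (Fin 3)) | (2 : ℝ≥0∞) ^ q ≤ dissipationWavenumber c ν w} := h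
    rw [indicator_of_mem hmem]
    have h' : (2 : ℝ≥0∞) ^ q ≤ dissipationWavenumber c₀ ν v :=
      h.trans (dissipationWavenumber_anti hc hν v)
    exact le_iSup₂ (f := fun (j : ℕ) (_ : (2 : ℝ≥0∞) ^ j ≤ dissipationWavenumber c₀ ν v) =>
      (2 : ℝ≥0∞) ^ j * eLpNorm (blockFn (j : ℤ) v) ⊤ volume) q h'
  · have hmem : v ∉ {w : (EuclideanSpace ℝ (Fin 3)) → (EuclideanSpace ℝ (Fin 3)) | (2 : ℝ≥0∞) ^ q ≤ dissipationWavenumber c ν w} := h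
    rw [indicator_of_notMem hmem]
    exact bot_le

/-- **Registered stub `stub_cs14Criterion` of crux `NoThinFrontierBlowup` (stmt-NavierStokesRegularity-27233),
verbatim** — the Cheskidov–Shvydkoy / Cheskidov–Dai dissipation-range criterion in the Clay class, from the tree's
proved Cheskidov–Dai occupation theorem. [cite: CheskidovDai2015, §1 Thm. 1.1 (case b ≡ 0, r = ∞)] -/
theorem stub_cs14Criterion : ∃ cs : ℝ, 0 < cs ∧ cs ≤ 1 ∧ ∀ c₀ : ℝ, 0 < c₀ → c₀ ≤ cs → ∀ (ν T : ℝ), 0 < ν → 0 < T → ∀ (u : ℝ → EuclideanSpace ℝ (Fin 3) → EuclideanSpace ℝ (Fin 3)) (p : ℝ → EuclideanSpace ℝ (Fin 3) → ℝ), Literature.Analysis.FluidPDE.IsClassicalNSSolutionOn (Set.Ico 0 T) ν 0 u p → Literature.Analysis.FluidPDE.IsLerayHopfOn T ν 0 (u 0) u → Literature.Analysis.FluidPDE.HasRapidSpatialDecay (u 0) → ∀ t₀ : ℝ, 0 ≤ t₀ → t₀ < T → (∫⁻ t in Set.Ioo t₀ T, (⨆ (j : ℕ) (_ : (2 : ENNReal)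 ^ j ≤ Literature.Analysis.FluidPDE.dissipationWavenumber c₀ ν (u t)), (2 : ENNReal) ^ j * MeasureTheory.eLpNorm (Literature.Analysis.FunctionSpaces.blockFn (j : ℤ) (u t)) ⊤ MeasureTheory.volume)) < ⊤ → Literature.Analysis.FluidPDE.HasSmoothExtensionPast ν 0 u T := by
  obtain ⟨c, hc, hCD⟩ := cheskidov_dai_occupation_holds
  refine ⟨min c 1, lt_min hc one_pos, min_le_right _ _, ?_⟩
  intro c₀ hc₀ hc₀s ν T hν hT u p hsol hLH h₀ t₀ ht₀ ht₀T hint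
  have hc₀c : c₀ ≤ c := hc₀s.trans (min_le_left _ _)
  -- names
  set G : ℝ → ℝ≥0∞ := fun t => ⨆ (j : ℕ) (_ : (2 : ℝ≥0∞) ^ j ≤ dissipationWavenumber c₀ ν (u t)),
    (2 : ℝ≥0∞) ^ j * eLpNorm (blockFn (j : ℤ) (u t)) ⊤ volume with hG
  set Fq : ℕ → ℝ → ℝ≥0∞ := fun q τ => {τ' : ℝ | (2 : ℝ≥0∞) ^ q ≤ dissipationWavenumber c ν (u τ')}.indicator
    (fun τ' => (2 : ℝ≥0∞) ^ q * eLpNorm (blockFn (q : ℤ) (u τ')) ∞ volume) τ with hFq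
  have hFG : ∀ q τ, Fq q τ ≤ G τ := fun q τ => by
    simp only [hFq, hG]
    have h := occupation_le_criticalSup hc₀c hν.le (u τ) q
    simpa only [Set.indicator, mem_setOf_eq] using h
  apply hCD ν T hν hT u p hsol hLH h₀
  show limsup (fun q : ℕ => ∫⁻ τ in Ioo (T / 2) T, Fq q τ) atTop ≤ ENNReal.ofReal c
  -- (i) absolute continuity: a terminal layer `(T - δ, T)` of small `G`-mass
  set μ : Measure ℝ := volume.restrict (Ioo t₀ T) with hμ
  have hGfin : ∫⁻ t, G t ∂μ ≠ ∞ := hint.ne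
  have hmeas : Tendsto (μ ∘ fun δ : ℝ => Ioo (T - δ) T) (𝓝[>] (0 : ℝ)) (𝓝 0) := by
    have h1 : ∀ δ : ℝ, (μ ∘ fun δ : ℝ => Ioo (T - δ) T) δ ≤ ENNReal.ofReal δ := fun δ => by
      simp only [comp_apply, hμ]
      exact (Measure.restrict_apply_le _ _).trans (by rw [Real.volume_Ioo, sub_sub_cancel])
    have h2 : Tendsto (fun δ : ℝ => ENNReal.ofReal δ) (𝓝[>] (0 : ℝ)) (𝓝 0) := by
      have h3 : Tendsto (fun δ : ℝ => δ) (𝓝[>] (0 : ℝ)) (𝓝 0) :=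
        tendsto_nhdsWithin_of_tendsto_nhds tendsto_id
      simpa using ENNReal.tendsto_ofReal h3
    exact tendsto_of_tendsto_of_tendsto_of_le_of_le tendsto_const_nhds h2 (fun _ => bot_le) h1
  have hsmall : ∀ᶠ δ in 𝓝[>] (0 : ℝ), ∫⁻ t in Ioo (T - δ) T, G t ∂μ < ENNReal.ofReal c :=
    (tendsto_order.1 (tendsto_setLIntegral_zero hGfin hmeas)).2 _ (ENNReal.ofReal_pos.2 hc)
  have hδT : ∀ᶠ δ in 𝓝[>] (0 : ℝ), δ < T - t₀ :=
    (eventually_lt_nhds (by linarith : (0 : ℝ) < T - t₀)).filter_mono nhdsWithin_le_nhds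
  have hpos : ∀ᶠ δ in 𝓝[>] (0 : ℝ), 0 < δ := eventually_nhdsWithin_of_forall fun δ hδ => hδ
  obtain ⟨δ, hδc, hδT, hδ⟩ := (hsmall.and (hδT.and hpos)).exists
  -- the layer integral w.r.t. `volume`
  have hlayer : ∫⁻ t in Ioo (T - δ) T, G t ≤ ENNReal.ofReal c := by
    have hsub : Ioo (T - δ) T ⊆ Ioo t₀ T := Ioo_subset_Ioo (by linarith) le_rfl
    have hre : μ.restrict (Ioo (T - δ) T) = volume.restrict (Ioo (T - δ) T) := by
      rw [hμ, Measure.restrict_restrict measurableSet_Ioo, inter_eq_left.2 hsub]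
    rw [← hre]
    exact hδc.le
  -- (ii) below `T - δ` the occupation integrand vanishes for large `q`
  have hT₁ : T - δ ∈ Ioo 0 T := ⟨by linarith, by linarith⟩
  obtain ⟨q₁, hq₁⟩ := exists_level_cutoff_of_classical hν hsol hLH h₀ hc hT₁
  have hzero : ∀ q : ℕ, q₁ ≤ q → ∫⁻ τ in Ioc (T / 2) (T - δ), Fq q τ = 0 := by
    intro q hq
    have h0 : ∀ τ ∈ Ioc (T / 2) (T - δ), Fq q τ = 0 := fun τ hτ => by
      simp only [hFq]
      rw [indicator_of_notMem]
      exact hq₁ q hq τ ⟨by linarith [hτ.1], hτ.2⟩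
    rw [setLIntegral_congr_fun measurableSet_Ioc h0, lintegral_zero]
  -- every occupation integral with `q ≥ q₁` is at most `c`
  have hbound : ∀ q : ℕ, q₁ ≤ q → ∫⁻ τ in Ioo (T / 2) T, Fq q τ ≤ ENNReal.ofReal c := by
    intro q hq
    have hcover : Ioo (T / 2) T ⊆ Ioc (T / 2) (T - δ) ∪ Ioo (T - δ) T := fun τ hτ => by
      by_cases h : τ ≤ T - δ
      · exact Or.inl ⟨hτ.1, h⟩
      · exact Or.inr ⟨lt_of_not_ge h, hτ.2⟩
    calc ∫⁻ τ in Ioo (T / 2) T, Fq q τ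
        ≤ ∫⁻ τ in Ioc (T / 2) (T - δ) ∪ Ioo (T - δ) T, Fq q τ := lintegral_mono_set hcover
      _ ≤ (∫⁻ τ in Ioc (T / 2) (T - δ), Fq q τ) + ∫⁻ τ in Ioo (T - δ) T, Fq q τ :=
        lintegral_union_le (μ := volume) (fun τ => Fq q τ) (Ioc (T / 2) (T - δ)) (Ioo (T - δ) T)
      _ ≤ 0 + ∫⁻ τ in Ioo (T - δ) T, G τ :=
        add_le_add (hzero q hq).le (lintegral_mono fun τ => hFG q τ)
      _ = ∫⁻ τ in Ioo (T - δ) T, G τ := zero_add _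
      _ ≤ ENNReal.ofReal c := hlayer
  exact Filter.limsup_le_of_le (h := Filter.eventually_atTop.2 ⟨q₁, hbound⟩)

end Summit.NavierStokesRegularity.NavierStokesRegularity.Theorems.NoThinFrontierBlowup
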